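import Summits.Ventures.YMGap.RobustBall.AxialTowerWitness
import HarnessLib

/-!
# RobustBall/AxialTowerMember — the axial-tower witness lies in the TIER-2 ball with explicit, `L`-uniform loads
(cell `pub-ymgap`, track Y2 ROBUST-BALL; ds-4)

HONEST FRAMING: a MEMBERSHIP CERTIFICATE (finite-torus bookkeeping; no expansion, no continuum, no Clay claim).  For the axial-tower
action of `RobustBall/AxialTowerWitness` (coefficients `τ θ^s/2` on parallel plaquette pairs at axial separation `s`) and a weight
`κ ≥ 0` with `q := e^{κ} θ < 1` (`θ ≥ 0`), the WEIGHTED loads are bounded uniformly in the torus size `L`: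
oscillation `Σ_r e^{κ diam} oscC_r mult_r(e) ≤ 8(d−1)(d−2)|τ| e^{κ} q/(1−q)` and Lipschitz mass
`Σ_{r ∋ e.1} e^{κ diam} lipC_r |letters_r| ≤ 24 d(d−1)(d−2)(|τ|/√N) e^{κ} q/(1−q)` (`diam ≤ s + 1`, `8` letters, `≤ 6` base points per
triple, `d(d−1)(d−2)` ordered triples, geometric tail `Σ_{s ≤ L} q^s ≤ q/(1−q)`), so
`towerWitness ∈ ClusterDomain κ ε₀ ε₁` with these radii (`towerWitness_mem_clusterDomain`) — a member of the hypothesis class of the tier-2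
area law `AreaLawOnBallW` (with `IsSlabLocal 2` from the witness file) whose polymers have UNBOUNDED diameter.  (Bookkeeping remarks: the
separation index runs over `s = 1, …, L`, so on the torus the partner `p + s e_k` wraps around and at `s = L` coincides with `p` — a harmless
plaquette-squared term, counted in the loads like every other; for `d ≤ 2` there is no transverse direction and the witness is `0`.)
-/

noncomputable section

open MeasureTheory Finset Function
open Literature.Probability.LatticeModels Literature.Probability.LatticeModels.DobrushinMetric
open Literature.MathematicalPhysics.QuantumLattice hiding torusNorm
open Literature.MathematicalPhysics.QuantumFieldTheory hiding ZdEdge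

namespace Summit.Ventures.YMGap.RobustBall

variable {d L N : ℕ}

/-! ### Elementary sums -/

/-- Geometric tail: `Σ_{m < n} q^{m+1} ≤ q/(1 − q)` for `0 ≤ q < 1`. [folklore] -/
theorem geom_shift_sum_le {q : ℝ} (hq0 : 0 ≤ q) (hq1 : q < 1) (n : ℕ) :
    ∑ m ∈ range n, q ^ (m + 1) ≤ q / (1 - q) := by
  have h1 : (∑ m ∈ range n, q ^ m) * (1 - q) = 1 - q ^ n := geom_sum_mul_neg q n
  have hqn : 0 ≤ q ^ n := pow_nonneg hq0 n
  have h1q : 0 < 1 - q := by linarith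
  have hS : ∑ m ∈ range n, q ^ m ≤ 1 / (1 - q) := by rw [le_div_iff₀ h1q]; linarith
  calc ∑ m ∈ range n, q ^ (m + 1) = q * ∑ m ∈ range n, q ^ m := by
        rw [mul_sum]; exact sum_congr rfl fun m _ => by ring
    _ ≤ q * (1 / (1 - q)) := mul_le_mul_of_nonneg_left hS hq0
    _ = q / (1 - q) := by ring

/-- The weight of a tower term: `e^{κ(m+2)} θ^{m+1} = e^{κ} (e^{κ} θ)^{m+1}`. [folklore] -/
theorem exp_mul_add_two_mul_pow (κ θ : ℝ) (m : ℕ) :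
    Real.exp (κ * ((m : ℝ) + 2)) * θ ^ (m + 1) = Real.exp κ * (Real.exp κ * θ) ^ (m + 1) := by
  rw [mul_pow, ← Real.exp_nat_mul, ← mul_assoc, ← Real.exp_add]
  congr 1; push_cast; ring_nf

/-- Multiplicity of an appended word. [folklore] -/
theorem mult_append (w₁ w₂ : List (Letter d L)) (e : Edge d L) : mult (w₁ ++ w₂) e = mult w₁ e + mult w₂ e := by
  simp [mult, List.map_append, List.count_append]

/-- Membership in a translated plaquette code. [folklore] -/
theorem mem_plaqCode_add_iff {x c y : Site d L} {i j : Fin d} : y ∈ plaqCode (x + c) i j ↔ y - c ∈ plaqCode x i j := by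
  simp only [plaqCode, mem_insert, mem_singleton, sub_eq_iff_eq_add, add_right_comm x c]

variable [NeZero L]

/-- **Letters of the tower family through a link, summed over base points and triples**: `8(d−1)(d−2)` at every separation. [folklore] -/
theorem sum_mult_tower (N : ℕ) (τ θ : ℝ) (m : Fin L) (e : Edge d L) :
    ∑ p : Site d L × OTrip d, mult (towerFamily d L N τ θ (p, m)).letters e = 8 * ((d - 1) * (d - 2)) := by
  rw [Fintype.sum_prod_type, sum_comm]
  have hx : ∀ t : OTrip d, ∑ x : Site d L, mult (towerFamily d L N τ θ ((x, t), m)).letters e =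
      4 * (if (t.1.1 : Fin d) = e.2 then 1 else 0) + 4 * (if (t.1.2.1 : Fin d) = e.2 then 1 else 0) := by
    intro t
    simp only [towerFamily_letters, mult_append, sum_add_distrib, sum_mult_plaqWord_add, sum_mult_plaqWord]
    ring
  rw [sum_congr rfl fun t _ => hx t, sum_add_distrib, ← mul_sum, ← mul_sum, sum_otrip_ite_fst, sum_otrip_ite_snd]
  ring

/-- At most six base points put a given site into a tower polymer (three per plaquette code). [folklore] -/
theorem card_filter_mem_towerCode_le (y : Site d L) (i j k : Fin d) (m : ℕ) :
    (univ.filter fun x : Site d L => y ∈ towerCode x i j k m).card ≤ 6 := by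
  classical
  have hsplit : (univ.filter fun x : Site d L => y ∈ towerCode x i j k m) ⊆
      (univ.filter fun x : Site d L => y ∈ plaqCode x i j) ∪
        (univ.filter fun x : Site d L => y - axialShiftT k m ∈ plaqCode x i j) := by
    intro x hx
    simp only [mem_filter, mem_univ, true_and, towerCode, mem_union] at hx ⊢
    rcases hx with h | h
    · exact Or.inl h
    · exact Or.inr (mem_plaqCode_add_iff.1 h)
  calc (univ.filter fun x : Site d L => y ∈ towerCode x i j k m).card
      ≤ ((univ.filter fun x : Site d L => y ∈ plaqCode x i j) ∪
          (univ.filter fun x : Site d L => y - axialShiftT k m ∈ plaqCode x i j)).card := card_le_card hsplit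
    _ ≤ (univ.filter fun x : Site d L => y ∈ plaqCode x i j).card +
          (univ.filter fun x : Site d L => y - axialShiftT k m ∈ plaqCode x i j).card := card_union_le _ _
    _ ≤ 3 + 3 := add_le_add (card_filter_mem_plaqCode_le y i j) (card_filter_mem_plaqCode_le _ i j)

/-- **Base points × triples whose tower polymer contains a given site**: at most `6 d(d−1)(d−2)` at every separation. [folklore] -/
theorem sum_ite_mem_towerCode_le (y : Site d L) (m : ℕ) :
    ∑ p : Site d L × OTrip d, (if y ∈ towerCode p.1 p.2.1.1 p.2.1.2.1 p.2.1.2.2 m then (1 : ℝ) else 0) ≤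
      6 * ((d * (d - 1) * (d - 2) : ℕ) : ℝ) := by
  classical
  rw [Fintype.sum_prod_type, sum_comm]
  have hinner : ∀ t : OTrip d, ∑ x : Site d L, (if y ∈ towerCode x t.1.1 t.1.2.1 t.1.2.2 m then (1 : ℝ) else 0) ≤ 6 := by
    intro t
    rw [← sum_filter, sum_const, nsmul_eq_mul, mul_one]
    exact_mod_cast card_filter_mem_towerCode_le y t.1.1 t.1.2.1 t.1.2.2 m
  calc ∑ t : OTrip d, ∑ x : Site d L, (if y ∈ towerCode x t.1.1 t.1.2.1 t.1.2.2 m then (1 : ℝ) else 0)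
      ≤ ∑ _t : OTrip d, (6 : ℝ) := sum_le_sum fun t _ => hinner t
    _ = 6 * ((d * (d - 1) * (d - 2) : ℕ) : ℝ) := by
        rw [sum_const, nsmul_eq_mul, ← sum_otrip_one (d := d)]; push_cast; simp [sum_const]; ring

/-! ### The weighted loads of the tower witness -/

section Loads

variable (N : ℕ) (τ θ κ : ℝ)

omit [NeZero L] in
/-- Termwise weight bound: `e^{κ diam(code r)} ≤ e^{κ(m+2)}` for a tower term at separation `m + 1` (`κ ≥ 0`). [folklore] -/
theorem exp_diam_tower_le (hκ : 0 ≤ κ) (r : (Site d L × OTrip d) × Fin L) :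
    Real.exp (κ * polymerDiam (towerFamily d L N τ θ r).code) ≤ Real.exp (κ * (((r.2 : ℕ) : ℝ) + 2)) := by
  refine Real.exp_le_exp.2 (mul_le_mul_of_nonneg_left ?_ hκ)
  have h := polymerDiam_towerCode_le (x := r.1.1) (k := r.1.2.1.2.2) r.1.2.2.1 (r.2 : ℕ)
  rw [towerFamily_code]
  exact_mod_cast h

/-- **Weighted oscillation load of the tower witness**: `≤ 8(d−1)(d−2)|τ| e^{κ} q/(1−q)`, `q = e^{κ}θ < 1`, uniformly in `L`. [folklore] -/
theorem tower_oscSum_le (hd : 2 ≤ d) (hκ : 0 ≤ κ) (hθ : 0 ≤ θ) (hq : Real.exp κ * θ < 1) (e : Edge d L) :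
    ∑ r, Real.exp (κ * polymerDiam (towerFamily d L N τ θ r).code) *
        ((towerFamily d L N τ θ r).oscC * (mult (towerFamily d L N τ θ r).letters e : ℝ)) ≤
      8 * ((d : ℝ) - 1) * ((d : ℝ) - 2) * |τ| * Real.exp κ * (Real.exp κ * θ / (1 - Real.exp κ * θ)) := by
  set q : ℝ := Real.exp κ * θ with hqdef
  have hq0 : 0 ≤ q := by positivity
  -- termwise
  have hterm : ∀ r : (Site d L × OTrip d) × Fin L,
      Real.exp (κ * polymerDiam (towerFamily d L N τ θ r).code) *
          ((towerFamily d L N τ θ r).oscC * (mult (towerFamily d L N τ θ r).letters e : ℝ)) ≤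
        (|τ| * Real.exp κ * q ^ ((r.2 : ℕ) + 1)) * (mult (towerFamily d L N τ θ r).letters e : ℝ) := by
    intro r
    rw [towerFamily_oscC N τ θ hθ, ← mul_assoc]
    refine mul_le_mul_of_nonneg_right ?_ (Nat.cast_nonneg _)
    calc Real.exp (κ * polymerDiam (towerFamily d L N τ θ r).code) * (|τ| * θ ^ ((r.2 : ℕ) + 1))
        ≤ Real.exp (κ * (((r.2 : ℕ) : ℝ) + 2)) * (|τ| * θ ^ ((r.2 : ℕ) + 1)) :=
          mul_le_mul_of_nonneg_right (exp_diam_tower_le N τ θ κ hκ r) (by positivity)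
      _ = |τ| * (Real.exp (κ * (((r.2 : ℕ) : ℝ) + 2)) * θ ^ ((r.2 : ℕ) + 1)) := by ring
      _ = |τ| * Real.exp κ * q ^ ((r.2 : ℕ) + 1) := by rw [exp_mul_add_two_mul_pow]; ring
  refine (sum_le_sum fun r _ => hterm r).trans ?_
  -- sum over the separation last
  rw [Fintype.sum_prod_type_right]
  have hinner : ∀ m : Fin L, ∑ p : Site d L × OTrip d,
      (|τ| * Real.exp κ * q ^ ((m : ℕ) + 1)) * (mult (towerFamily d L N τ θ (p, m)).letters e : ℝ) =
        (|τ| * Real.exp κ * q ^ ((m : ℕ) + 1)) * (8 * (((d : ℝ) - 1) * ((d : ℝ) - 2))) := by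
    intro m
    rw [← mul_sum]
    congr 1
    have h := sum_mult_tower (L := L) N τ θ m e
    have hcast : ((∑ p : Site d L × OTrip d, mult (towerFamily d L N τ θ (p, m)).letters e : ℕ) : ℝ) =
        ((8 * ((d - 1) * (d - 2)) : ℕ) : ℝ) := by rw [h]
    push_cast at hcast
    rw [hcast, Nat.cast_sub (by omega), Nat.cast_sub hd]; push_cast; ring
  rw [sum_congr rfl fun m _ => hinner m, ← sum_mul]
  have hgeom : ∑ m : Fin L, |τ| * Real.exp κ * q ^ ((m : ℕ) + 1) ≤ |τ| * Real.exp κ * (q / (1 - q)) := by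
    rw [← mul_sum, Fin.sum_univ_eq_sum_range (fun i => q ^ (i + 1)) L]
    exact mul_le_mul_of_nonneg_left (geom_shift_sum_le hq0 hq L) (by positivity)
  have hdd : 0 ≤ 8 * (((d : ℝ) - 1) * ((d : ℝ) - 2)) := by
    have h1 : (1 : ℝ) ≤ d := by exact_mod_cast (show 1 ≤ d by omega)
    have h2 : (2 : ℝ) ≤ d := by exact_mod_cast hd
    nlinarith
  calc (∑ m : Fin L, |τ| * Real.exp κ * q ^ ((m : ℕ) + 1)) * (8 * (((d : ℝ) - 1) * ((d : ℝ) - 2)))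
      ≤ (|τ| * Real.exp κ * (q / (1 - q))) * (8 * (((d : ℝ) - 1) * ((d : ℝ) - 2))) :=
        mul_le_mul_of_nonneg_right hgeom hdd
    _ = _ := by ring

/-- **Weighted Lipschitz mass of the tower witness at a link**: `≤ 24 d(d−1)(d−2)(|τ|/√N) e^{κ} q/(1−q)`, uniformly in `L`. [folklore] -/
theorem tower_lipSum_le (hκ : 0 ≤ κ) (hθ : 0 ≤ θ) (hq : Real.exp κ * θ < 1) (e : Edge d L) :
    ∑ r, (if e.1 ∈ (towerFamily d L N τ θ r).code then
        Real.exp (κ * polymerDiam (towerFamily d L N τ θ r).code) *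
          ((towerFamily d L N τ θ r).lipC * ((towerFamily d L N τ θ r).letters.length : ℝ)) else 0) ≤
      24 * ((d * (d - 1) * (d - 2) : ℕ) : ℝ) * (|τ| / Real.sqrt N) * Real.exp κ * (Real.exp κ * θ / (1 - Real.exp κ * θ)) := by
  set q : ℝ := Real.exp κ * θ with hqdef
  have hq0 : 0 ≤ q := by positivity
  have hterm : ∀ r : (Site d L × OTrip d) × Fin L,
      (if e.1 ∈ (towerFamily d L N τ θ r).code then
        Real.exp (κ * polymerDiam (towerFamily d L N τ θ r).code) *
          ((towerFamily d L N τ θ r).lipC * ((towerFamily d L N τ θ r).letters.length : ℝ)) else 0) ≤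
        (if e.1 ∈ towerCode r.1.1 r.1.2.1.1 r.1.2.1.2.1 r.1.2.1.2.2 r.2 then (1 : ℝ) else 0) *
          (4 * (|τ| / Real.sqrt N) * Real.exp κ * q ^ ((r.2 : ℕ) + 1)) := by
    intro r
    rw [towerFamily_code]
    split_ifs with h
    · rw [one_mul, towerFamily_lipC N τ θ hθ, towerFamily_length]
      calc Real.exp (κ * polymerDiam (towerCode r.1.1 r.1.2.1.1 r.1.2.1.2.1 r.1.2.1.2.2 r.2)) *
            (|τ| * θ ^ ((r.2 : ℕ) + 1) / 2 / Real.sqrt N * ((8 : ℕ) : ℝ))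
          ≤ Real.exp (κ * (((r.2 : ℕ) : ℝ) + 2)) * (|τ| * θ ^ ((r.2 : ℕ) + 1) / 2 / Real.sqrt N * ((8 : ℕ) : ℝ)) :=
            mul_le_mul_of_nonneg_right (by simpa using exp_diam_tower_le N τ θ κ hκ r) (by positivity)
        _ = 4 * (|τ| / Real.sqrt N) * (Real.exp (κ * (((r.2 : ℕ) : ℝ) + 2)) * θ ^ ((r.2 : ℕ) + 1)) := by
            push_cast; ring
        _ = 4 * (|τ| / Real.sqrt N) * Real.exp κ * q ^ ((r.2 : ℕ) + 1) := by rw [exp_mul_add_two_mul_pow]; ring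
    · simp
  refine (sum_le_sum fun r _ => hterm r).trans ?_
  rw [Fintype.sum_prod_type_right]
  have hinner : ∀ m : Fin L, ∑ p : Site d L × OTrip d,
      (if e.1 ∈ towerCode p.1 p.2.1.1 p.2.1.2.1 p.2.1.2.2 m then (1 : ℝ) else 0) *
        (4 * (|τ| / Real.sqrt N) * Real.exp κ * q ^ ((m : ℕ) + 1)) ≤
        6 * ((d * (d - 1) * (d - 2) : ℕ) : ℝ) * (4 * (|τ| / Real.sqrt N) * Real.exp κ * q ^ ((m : ℕ) + 1)) := by
    intro m
    rw [← sum_mul]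
    exact mul_le_mul_of_nonneg_right (sum_ite_mem_towerCode_le e.1 m) (by positivity)
  refine (sum_le_sum fun m _ => hinner m).trans ?_
  rw [← mul_sum]
  have hgeom : ∑ m : Fin L, 4 * (|τ| / Real.sqrt N) * Real.exp κ * q ^ ((m : ℕ) + 1) ≤
      4 * (|τ| / Real.sqrt N) * Real.exp κ * (q / (1 - q)) := by
    rw [← mul_sum, Fin.sum_univ_eq_sum_range (fun i => q ^ (i + 1)) L]
    exact mul_le_mul_of_nonneg_left (geom_shift_sum_le hq0 hq L) (by positivity)
  calc 6 * ((d * (d - 1) * (d - 2) : ℕ) : ℝ) * ∑ m : Fin L, 4 * (|τ| / Real.sqrt N) * Real.exp κ * q ^ ((m : ℕ) + 1)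
      ≤ 6 * ((d * (d - 1) * (d - 2) : ℕ) : ℝ) * (4 * (|τ| / Real.sqrt N) * Real.exp κ * (q / (1 - q))) :=
        mul_le_mul_of_nonneg_left hgeom (by positivity)
    _ = _ := by ring

/-- **THE AXIAL-TOWER WITNESS IS IN THE TIER-2 BALL**, uniformly in the torus size: for `d ≥ 2`, `0 ≤ κ`, `0 ≤ θ`, `e^{κ}θ < 1`,
`towerWitness ∈ ClusterDomain κ ε₀ ε₁` with `ε₀ = 8(d−1)(d−2)|τ| e^{κ} q/(1−q)`, `ε₁ = 24 d(d−1)(d−2)(|τ|/√N) e^{κ} q/(1−q)`,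
`q = e^{κ}θ` — an INFINITE-RANGE member (pairs at every axial separation `s ≤ L`, polymer diameter `s + 1`) of the diameter-weighted
ball, slab-local with vertical dependence diameter `2` (`isSlabLocal_towerWitness`). [folklore] -/
theorem towerWitness_mem_clusterDomain (hd : 2 ≤ d) (hκ : 0 ≤ κ) (hθ : 0 ≤ θ) (hq : Real.exp κ * θ < 1) :
    towerWitness d L N τ θ ∈ ClusterDomain κ
      (8 * ((d : ℝ) - 1) * ((d : ℝ) - 2) * |τ| * Real.exp κ * (Real.exp κ * θ / (1 - Real.exp κ * θ)))
      (24 * ((d * (d - 1) * (d - 2) : ℕ) : ℝ) * (|τ| / Real.sqrt N) * Real.exp κ * (Real.exp κ * θ / (1 - Real.exp κ * θ))) :=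
  termPerturbation_mem_clusterDomain _ (fun e => tower_oscSum_le N τ θ κ hd hκ hθ hq e) (fun e => tower_lipSum_le N τ θ κ hκ hθ hq e)

end Loads

/-! ### Infinite range: the witness is in no tier-1 ball uniformly in `L` -/

section InfiniteRange

variable (N : ℕ) (τ θ : ℝ)

omit [NeZero L] in
/-- The word holonomy of the trivial configuration is `1`. [folklore] -/
theorem wordProd_const_one (w : List (Letter d L)) : wordProd w (fun _ : Edge d L => (1 : SUN N)) = 1 := by
  induction w with
  | nil => rfl
  | cons l w ih => simp [wordProd_cons, Letter.hol, ih]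

omit [NeZero L] in
/-- The normalised trace of the trivial configuration is `1` (`N ≥ 1`). [folklore] -/
theorem traceObs_const_one (hN : 1 ≤ N) (w : List (Letter d L)) : traceObs N w (fun _ : Edge d L => (1 : SUN N)) = 1 := by
  have hN0 : (N : ℝ) ≠ 0 := by exact_mod_cast (show N ≠ 0 by omega)
  rw [traceObs, wordProd_const_one]
  simp [Matrix.trace_one, hN0]

/-- At the trivial configuration the activity of the tower witness on the polymer of any tower term is POSITIVE (`τ, θ > 0`): every term
placed there contributes `τ θ^{s}/2 > 0`. [folklore] -/
theorem towerWitness_act_one_pos (hN : 1 ≤ N) (hτ : 0 < τ) (hθ : 0 < θ) (r₀ : (Site d L × OTrip d) × Fin L) :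
    0 < (towerWitness d L N τ θ).act (towerFamily d L N τ θ r₀).code (fun _ => 1) := by
  simp only [towerWitness, termPerturbation_act]
  refine Finset.sum_pos (fun r _ => ?_) ⟨r₀, (mem_fiber _).2 rfl⟩
  show 0 < pairActivity N (τ * θ ^ ((r.2 : ℕ) + 1) / 2) _ _ _
  rw [pairActivity, traceObs_const_one N hN, traceObs_const_one N hN]
  positivity

/-- **INFINITE RANGE**: for `τ, θ > 0`, any transverse triple and every `r` with `2(r+1) ≤ L`, the tower witness on the torus `(ℤ/L)^d` is
NOT of range `r` — the pair at axial separation `r + 1` sits on a polymer of diameter `≥ r + 1` and carries a non-zero activity.  Hence no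
tier-1 ball `ClusterDomainFR ε₀ ε₁ r` contains the family for all `L`. [folklore] -/
theorem not_hasRange_towerWitness (hN : 1 ≤ N) (hτ : 0 < τ) (hθ : 0 < θ) (t : OTrip d) {r : ℕ} (hr : 2 * (r + 1) ≤ L) :
    ¬ HasRange r (towerWitness d L N τ θ) := by
  intro h
  have hrL : r < L := by omega
  set r₀ : (Site d L × OTrip d) × Fin L := (((0 : Site d L), t), ⟨r, hrL⟩) with hr₀
  have hdiam : r < polymerDiam (towerFamily d L N τ θ r₀).code := by
    rw [towerFamily_code]
    have h0 : (0 : Site d L) ∈ towerCode (0 : Site d L) t.1.1 t.1.2.1 t.1.2.2 r :=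
      mem_union_left _ (by simp [plaqCode])
    have h1 : (0 : Site d L) + axialShiftT t.1.2.2 r ∈ towerCode (0 : Site d L) t.1.1 t.1.2.1 t.1.2.2 r :=
      mem_union_right _ (by simp [plaqCode])
    have hle := torusNorm_sub_le_polymerDiam h1 h0
    have hnorm : r + 1 ≤ torusNorm ((0 : Site d L) + axialShiftT t.1.2.2 r - 0) := by
      rw [zero_add, sub_zero]
      refine le_trans (le_of_eq ?_) (natAbs_valMinAbs_le_torusNorm _ t.1.2.2)
      rw [axialShiftT_apply_self, ZMod.valMinAbs_natCast_of_le_half (by omega)]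
      omega
    exact Nat.lt_of_lt_of_le (Nat.lt_succ_self r) (hnorm.trans hle)
  have hzero := congrFun (h _ hdiam) (fun _ => 1)
  have hpos := towerWitness_act_one_pos N τ θ hN hτ hθ r₀
  rw [hzero] at hpos
  exact lt_irrefl _ hpos

/-- **Not in any tier-1 ball, uniformly in `L`**: for `τ, θ > 0`, `d ≥ 3` (a transverse triple exists) and every range `r` and radii
`ε₀, ε₁`, the tower witness on the torus of size `L ≥ 2(r+1)` is NOT a member of `ClusterDomainFR ε₀ ε₁ r`. [folklore] -/
theorem towerWitness_not_mem_clusterDomainFR (hN : 1 ≤ N) (hτ : 0 < τ) (hθ : 0 < θ) (t : OTrip d) (ε₀ ε₁ : ℝ) {r : ℕ}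
    (hr : 2 * (r + 1) ≤ L) : towerWitness d L N τ θ ∉ ClusterDomainFR ε₀ ε₁ r :=
  fun hW => not_hasRange_towerWitness N τ θ hN hτ hθ t hr hW.1

end InfiniteRange

end Summit.Ventures.YMGap.RobustBall

end
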